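import Summits.Ventures.LatticeQCDFlow.Exactness.IMHVariationalPrinciple
import Summits.Ventures.LatticeQCDFlow.Exactness.IMHTauIntLeAcceptanceCeiling
import HarnessLib

/-!
# `τ_int` of the exact flow sampler under a change of MODEL: Dirichlet-form domination and the log-parity sandwich

HONEST FRAMING: exact (Metropolis-corrected) sampling algorithms for lattice gauge theory;
figures of merit are autocorrelation/cost numbers at stated couplings and volumes; no
continuum-physics claim.

Venture `LatticeQCDFlow` (cell pub-lqcd), topic `Exactness`; FANOUT row 4 (`s0-u1-b`, S0-B
implementation B: an INDEPENDENT code path for the same gauge-equivariant flow + independence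
Metropolis sampler, acceptance clause "`τ_int(Q)` A vs B within `1σ_comb`") — the `τ_int`
companion of `Scaling/AcceptanceModelLipschitz.lean` (the acceptance clause).  NEW WORK of the
cell over the tree's general-measure-space flow-sampler toolbox (`imhOp`, `imhFlow`,
`dirichlet_eq_half_sq`, `dirichlet_neumannSum_le`, `autocov_nonneg`, `Scoring.tauInt`) and the
test-function side of the variational principle (`IMHVariationalPrinciple.lean`); nothing is
cited as a fact.  Printed counterparts NAMED ONLY: Peskun 1973 (Biometrika 60, Thm 2.1.1; the
tree's `Literature.Probability.MarkovChains.PeskunOrdering`, finite) and Tierney 1998 (Ann. Appl.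
Probab. 8, Thm 4, general state space): off-diagonal domination of reversible kernels with a
common stationary law orders their asymptotic variances; the form with a constant `c` is the same
statement against the lazy chain `cK + (1 − c)·1`.  Here, for the flow sampler, an ELEMENTARY
route without spectral theory: model domination `q' ≥ c·q` dominates the symmetrised flow, hence
the Dirichlet form, and completing the square against the partial Neumann sums of the dominating
chain transfers the Green–Kubo sum.

## Setting

`(X, μ)` s-finite; target weight `w > 0` measurable integrable (the Boltzmann weight, the SAME for
both chains); two model (flow) densities `q, q' > 0` measurable with `∫ q = ∫ q' = 1`;
`K = imhOp μ w q`, `K' = imhOp μ w q'`; `g` bounded measurable; `C(k) = ∫ g (Kᵏ g) w`,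
`C'(k) = ∫ g (K'ᵏ g) w`; `𝓔, 𝓔'` the two Dirichlet forms; `τ_int = ½ + Σ_{k≥1} C(k)/C(0)`
(`Scoring.tauInt`), `τ'_int` likewise.

## What is proved

* `imhFlow_ge_of_model_ge`, `integrable_imhFlow_sq_sub`, **`dirichlet_ge_of_model_ge`** —
  `q' ≥ c·q` pointwise (`c ≥ 0`) ⇒ `𝓔'(v) ≥ c·𝓔(v)` for every bounded measurable `v`;
* **`partialSum_autocov_le_of_model_ge`**, **`greenKubo_le_of_model_ge`** — `q' ≥ c·q`, `c > 0`,
  `Σ C(k+1)` summable ⇒ `Σ C'(k+1)` summable and `C'(0) + Σ_{k≥0} C'(k+1) ≤ (C(0) + Σ_{k≥0} C(k+1))/c`;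
* **`imhOp_tauInt_le_of_model_ge`** — `τ'_int + ½ ≤ (τ_int + ½)/c` (`∫ g² w > 0`);
* `model_ge_of_logParity`, **`imhOp_tauInt_logParity_sandwich`** — `|log q' − log q| ≤ δ`
  pointwise ⇒ `Σ C'(k+1)` summable and `e^{−δ}(2τ_int + 1) ≤ 2τ'_int + 1 ≤ e^{δ}(2τ_int + 1)`;
  `imhOp_tauInt_sub_le_of_logParity` — the additive form `τ'_int − τ_int ≤ (e^{δ} − 1)(τ_int + ½)`
  (and symmetrically); `imhOp_tauInt_logParity_sandwich_of_weightMoment` — the sandwich with the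
  chain-side summability replaced by `∫ (w/q) w < ∞` and `∫ g w = 0` (then summable by
  `IMHTauIntLeAcceptanceCeiling`).

Reading for S0-B row 4 (no numerics implied): two codes that evaluate the SAME trained flow agree
on the model log-density up to a uniform parity `δ` (a measured column of an A-vs-B table); at the
common target their exact chains then have, for EVERY bounded observable (the topological charge
of a finite lattice included), `2τ_int + 1` within the factor `e^{δ}` of each other — so a
same-weights `τ_int` comparison can separate two implementations only by Monte-Carlo error, as
`Scaling/AcceptanceModelLipschitz` says of the acceptance (`|Δacc| ≤ e^{δ} − 1`).  For two
DIFFERENT trained models only the one-sided law survives: wherever one model carries at least `c`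
times the density of the other everywhere, its `2τ_int + 1` is at most `1/c` times the other's,
observable by observable.
NOT CLAIMED: a Lipschitz law of `τ_int` in the total-variation distance of the models (false:
`τ_int` is driven by the under-covered tail of the weights, `IMHTauIntExact`); sharpness of `1/c`
inside the flow-sampler class; HMC / local Metropolis; unbounded observables; any number for a
trained network.
-/

namespace Summit.Ventures.LatticeQCDFlow.Exactness

open Real MeasureTheory Filter Set Topology
open Summit.Ventures.LatticeQCDFlow.Scoring

variable {X : Type*} [MeasurableSpace X] {μ : Measure X} {w q : X → ℝ}

variable [SFinite μ]

/-! ## §1 Two models at one target: Dirichlet-form domination and the Green–Kubo comparison -/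

omit [MeasurableSpace X] [SFinite μ] in
/-- Model domination passes to the symmetrised flow: `q' ≥ c·q` pointwise (`c ≥ 0`) gives
`s'(t,t') ≥ c·s(t,t')`. -/
theorem imhFlow_ge_of_model_ge {q' : X → ℝ} (hw0 : ∀ t, 0 < w t) {c : ℝ} (hc : 0 ≤ c)
    (hqq : ∀ t, c * q t ≤ q' t) (t t' : X) : c * imhFlow w q t t' ≤ imhFlow w q' t t' := by
  unfold imhFlow
  rw [mul_min_of_nonneg _ _ hc]
  refine min_le_min ?_ ?_
  · calc c * (w t * q t') = w t * (c * q t') := by ring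
      _ ≤ w t * q' t' := mul_le_mul_of_nonneg_left (hqq t') (hw0 t).le
  · calc c * (w t' * q t) = w t' * (c * q t) := by ring
      _ ≤ w t' * q' t := mul_le_mul_of_nonneg_left (hqq t) (hw0 t').le

omit [SFinite μ] in
/-- The Dirichlet integrand `s(t,t') (v(t) − v(t'))²` is integrable on `μ ⊗ μ` for bounded
measurable `v`. -/
theorem integrable_imhFlow_sq_sub (hw0 : ∀ t, 0 < w t) (hwm : Measurable w) (hwi : Integrable w μ)
    (hq0 : ∀ t, 0 < q t) (hqm : Measurable q) (hqi : Integrable q μ) {v : X → ℝ}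
    (hvm : Measurable v) {B : ℝ} (hvb : ∀ t, |v t| ≤ B) :
    Integrable (fun p : X × X => imhFlow w q p.1 p.2 * (v p.1 - v p.2) ^ 2) (μ.prod μ) := by
  have hv2m : Measurable fun t => v t ^ 2 := hvm.pow_const 2
  have hv2b : ∀ t, |v t ^ 2| ≤ B ^ 2 := fun t => by
    rw [abs_pow]; exact pow_le_pow_left₀ (abs_nonneg _) (hvb t) 2
  have h1b : ∀ t : X, |(fun _ : X => (1:ℝ)) t| ≤ 1 := fun _ => by simp
  have hA : Integrable (fun p : X × X => imhFlow w q p.1 p.2 * (v p.1 ^ 2 * (1:ℝ))) (μ.prod μ) :=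
    integrable_imhFlow_form hw0 hwm hwi hq0 hqm hqi hv2m measurable_const hv2b h1b
  have hBB : Integrable (fun p : X × X => imhFlow w q p.1 p.2 * (v p.1 * v p.2)) (μ.prod μ) :=
    integrable_imhFlow_form hw0 hwm hwi hq0 hqm hqi hvm hvm hvb hvb
  have hC : Integrable (fun p : X × X => imhFlow w q p.1 p.2 * ((1:ℝ) * v p.2 ^ 2)) (μ.prod μ) :=
    integrable_imhFlow_form hw0 hwm hwi hq0 hqm hqi measurable_const hv2m h1b hv2b
  exact ((hA.sub (hBB.const_mul 2)).add hC).congr (Eventually.of_forall fun p => by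
    simp only [Pi.add_apply, Pi.sub_apply]; ring)

/-- **DIRICHLET-FORM DOMINATION**: at a common target, if the model densities satisfy
`q' ≥ c·q` pointwise (`c ≥ 0`) then `𝓔'(v) ≥ c·𝓔(v)` for every bounded measurable `v`
(`𝓔 = ½∫∫ s (v − v')²` and `s' ≥ c s`). -/
theorem dirichlet_ge_of_model_ge {q' : X → ℝ} (hw0 : ∀ t, 0 < w t) (hwm : Measurable w)
    (hwi : Integrable w μ) (hq0 : ∀ t, 0 < q t) (hqm : Measurable q) (hqi : Integrable q μ)
    (hq1 : ∫ z, q z ∂μ = 1) (hq0' : ∀ t, 0 < q' t) (hqm' : Measurable q') (hqi' : Integrable q' μ)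
    (hq1' : ∫ z, q' z ∂μ = 1) {c : ℝ} (hc : 0 ≤ c) (hqq : ∀ t, c * q t ≤ q' t) {v : X → ℝ}
    (hvm : Measurable v) {B : ℝ} (hvb : ∀ t, |v t| ≤ B) :
    c * ((∫ t, v t ^ 2 * w t ∂μ) - ∫ t, v t * imhOp μ w q v t * w t ∂μ)
      ≤ (∫ t, v t ^ 2 * w t ∂μ) - ∫ t, v t * imhOp μ w q' v t * w t ∂μ := by
  rw [dirichlet_eq_half_sq hw0 hwm hwi hq0 hqm hqi hq1 hvm hvb,
    dirichlet_eq_half_sq hw0 hwm hwi hq0' hqm' hqi' hq1' hvm hvb, ← mul_assoc, mul_comm c,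
    mul_assoc, ← integral_const_mul]
  refine mul_le_mul_of_nonneg_left ?_ (by norm_num)
  refine integral_mono ((integrable_imhFlow_sq_sub hw0 hwm hwi hq0 hqm hqi hvm hvb).const_mul c)
    (integrable_imhFlow_sq_sub hw0 hwm hwi hq0' hqm' hqi' hvm hvb) fun p => ?_
  show c * (imhFlow w q p.1 p.2 * (v p.1 - v p.2) ^ 2) ≤ imhFlow w q' p.1 p.2 * (v p.1 - v p.2) ^ 2
  rw [← mul_assoc]
  exact mul_le_mul_of_nonneg_right (imhFlow_ge_of_model_ge hw0 hc hqq p.1 p.2) (sq_nonneg _)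

/-- **THE PARTIAL GREEN–KUBO SUMS OF THE DOMINATING MODEL**: `w > 0`, two models `q, q' > 0`
(`∫ q = ∫ q' = 1`) with `q' ≥ c·q` pointwise, `c > 0`; `g` bounded measurable with summable
autocovariances under `K = imhOp μ w q`.  Then for every `N`, with `K' = imhOp μ w q'`:
`Σ_{k≤N} ∫ g (K'ᵏ g) w ≤ (∫ g² w + Σ_{k≥0} ∫ g (K^{k+1} g) w) / c`. -/
theorem partialSum_autocov_le_of_model_ge {q' : X → ℝ} (hw0 : ∀ t, 0 < w t) (hwm : Measurable w)
    (hwi : Integrable w μ) (hq0 : ∀ t, 0 < q t) (hqm : Measurable q) (hqi : Integrable q μ)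
    (hq1 : ∫ z, q z ∂μ = 1) (hq0' : ∀ t, 0 < q' t) (hqm' : Measurable q') (hqi' : Integrable q' μ)
    (hq1' : ∫ z, q' z ∂μ = 1) {c : ℝ} (hc : 0 < c) (hqq : ∀ t, c * q t ≤ q' t) {g : X → ℝ}
    (hgm : Measurable g) {B : ℝ} (hgb : ∀ t, |g t| ≤ B)
    (hs : Summable fun k => ∫ t, g t * ((imhOp μ w q)^[k + 1] g) t * w t ∂μ) (N : ℕ) :
    ∑ k ∈ Finset.range (N + 1), ∫ t, g t * ((imhOp μ w q')^[k] g) t * w t ∂μ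
      ≤ ((∫ t, g t ^ 2 * w t ∂μ) + ∑' k, ∫ t, g t * ((imhOp μ w q)^[k + 1] g) t * w t ∂μ) / c := by
  obtain ⟨hm, hb, -⟩ := neumannSum_facts hw0 hwm hq0' hqm' hqi' hq1' hgm hgb N
  have hdir' := dirichlet_neumannSum_le hw0 hwm hwi hq0' hqm' hqi' hq1' hgm hgb N
  -- `∫ g v'_N w = Σ_k C'(k)`
  have hterm : ∀ k, Integrable (fun t => g t * ((imhOp μ w q')^[k] g) t * w t) μ := fun k => by
    obtain ⟨hkm, hkb⟩ := imhOp_iterate_bdd (μ := μ) hw0 hwm hq0' hqm' hqi' hq1' k hgm hgb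
    exact integrable_mul_mul_weight hw0 hwm hwi hgm hkm hgb hkb
  have hinner : ∫ t, g t * (∑ k ∈ Finset.range (N + 1), ((imhOp μ w q')^[k] g) t) * w t ∂μ
      = ∑ k ∈ Finset.range (N + 1), ∫ t, g t * ((imhOp μ w q')^[k] g) t * w t ∂μ := by
    rw [← integral_finsetSum _ fun k _ => hterm k]
    refine integral_congr_ae (Eventually.of_forall fun t => ?_)
    show g t * (∑ k ∈ Finset.range (N + 1), ((imhOp μ w q')^[k] g) t) * w t
      = ∑ k ∈ Finset.range (N + 1), g t * ((imhOp μ w q')^[k] g) t * w t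
    rw [Finset.mul_sum, Finset.sum_mul]
  -- Dirichlet domination at `v'_N`
  have hcmp := dirichlet_ge_of_model_ge hw0 hwm hwi hq0 hqm hqi hq1 hq0' hqm' hqi' hq1' hc.le hqq hm hb
  -- the test function `c · v'_N` in the variational principle for `K`
  have hcm : Measurable fun x => c * ∑ k ∈ Finset.range (N + 1), ((imhOp μ w q')^[k] g) x :=
    hm.const_mul c
  have hcb : ∀ x, |c * ∑ k ∈ Finset.range (N + 1), ((imhOp μ w q')^[k] g) x| ≤ c * (((N : ℝ) + 1) * B) :=
    fun x => by rw [abs_mul, abs_of_pos hc]; exact mul_le_mul_of_nonneg_left (hb x) hc.le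
  have hvar := two_inner_sub_dirichlet_le_greenKubo hw0 hwm hwi hq0 hqm hqi hq1 hgm hgb hs hcm hcb
  rw [dirichlet_const_mul] at hvar
  have hlin : ∫ t, g t * (c * ∑ k ∈ Finset.range (N + 1), ((imhOp μ w q')^[k] g) t) * w t ∂μ
      = c * ∫ t, g t * (∑ k ∈ Finset.range (N + 1), ((imhOp μ w q')^[k] g) t) * w t ∂μ := by
    rw [← integral_const_mul]
    exact integral_congr_ae (Eventually.of_forall fun t => by ring)
  rw [hlin, hinner] at hvar
  -- assemble: `Σ C' ≤ 2Σ C' − 𝓔'(v'_N) ≤ 2Σ C' − c 𝓔(v'_N) ≤ S/c`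
  rw [le_div_iff₀ hc]
  nlinarith [mul_le_mul_of_nonneg_left hdir' hc.le, mul_le_mul_of_nonneg_left hcmp hc.le, hvar]

/-- **GREEN–KUBO COMPARISON UNDER MODEL DOMINATION**: `q' ≥ c·q` pointwise with `c > 0` and a
summable autocovariance series under `K = imhOp μ w q` give a summable series under
`K' = imhOp μ w q'` with `∫ g² w + Σ_{k≥0} ∫ g (K'^{k+1} g) w ≤ (∫ g² w + Σ_{k≥0} ∫ g (K^{k+1} g) w)/c`
(Peskun–Tierney ordering in quantitative form, for the flow sampler, without spectral theory). -/
theorem greenKubo_le_of_model_ge {q' : X → ℝ} (hw0 : ∀ t, 0 < w t) (hwm : Measurable w)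
    (hwi : Integrable w μ) (hq0 : ∀ t, 0 < q t) (hqm : Measurable q) (hqi : Integrable q μ)
    (hq1 : ∫ z, q z ∂μ = 1) (hq0' : ∀ t, 0 < q' t) (hqm' : Measurable q') (hqi' : Integrable q' μ)
    (hq1' : ∫ z, q' z ∂μ = 1) {c : ℝ} (hc : 0 < c) (hqq : ∀ t, c * q t ≤ q' t) {g : X → ℝ}
    (hgm : Measurable g) {B : ℝ} (hgb : ∀ t, |g t| ≤ B)
    (hs : Summable fun k => ∫ t, g t * ((imhOp μ w q)^[k + 1] g) t * w t ∂μ) :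
    Summable (fun k => ∫ t, g t * ((imhOp μ w q')^[k + 1] g) t * w t ∂μ)
    ∧ (∫ t, g t ^ 2 * w t ∂μ) + ∑' k, ∫ t, g t * ((imhOp μ w q')^[k + 1] g) t * w t ∂μ
      ≤ ((∫ t, g t ^ 2 * w t ∂μ) + ∑' k, ∫ t, g t * ((imhOp μ w q)^[k + 1] g) t * w t ∂μ) / c := by
  set C' : ℕ → ℝ := fun k => ∫ t, g t * ((imhOp μ w q')^[k] g) t * w t ∂μ with hC'def
  set S : ℝ := (∫ t, g t ^ 2 * w t ∂μ) + ∑' k, ∫ t, g t * ((imhOp μ w q)^[k + 1] g) t * w t ∂μ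
    with hSdef
  have hC0 : C' 0 = ∫ t, g t ^ 2 * w t ∂μ := by
    simp only [hC'def, Function.iterate_zero, id_eq]
    exact integral_congr_ae (Eventually.of_forall fun t => by ring)
  have hCnn : ∀ k, 0 ≤ C' k := fun k => autocov_nonneg hw0 hwm hwi hq0' hqm' hqi' hq1' hgm hgb k
  have hbound : ∀ N, ∑ k ∈ Finset.range N, C' (k + 1) ≤ S / c - ∫ t, g t ^ 2 * w t ∂μ := by
    intro N
    have h := partialSum_autocov_le_of_model_ge hw0 hwm hwi hq0 hqm hqi hq1 hq0' hqm' hqi' hq1'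
      hc hqq hgm hgb hs N
    rw [Finset.sum_range_succ'] at h
    change (∑ k ∈ Finset.range N, C' (k + 1)) + C' 0 ≤ S / c at h
    rw [hC0] at h
    linarith
  have hs' : Summable (fun k => C' (k + 1)) :=
    summable_of_sum_range_le (fun k => hCnn (k + 1)) hbound
  refine ⟨hs', ?_⟩
  have h := hs'.tsum_le_of_sum_range_le hbound
  change (∫ t, g t ^ 2 * w t ∂μ) + ∑' k, C' (k + 1) ≤ S / c
  linarith

/-- **`τ_int` UNDER MODEL DOMINATION.**  `w > 0` measurable integrable; models `q, q' > 0`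
measurable, `∫ q = ∫ q' = 1`, `q' ≥ c·q` pointwise, `c > 0`; `g` bounded measurable with
`∫ g² w > 0` and summable autocovariances under `K = imhOp μ w q`.  On `Scoring.tauInt`
(`ρ(k) = C(k)/∫ g² w`): `τ_int(g; K') + ½ ≤ (τ_int(g; K) + ½)/c`, i.e.
`2τ'_int + 1 ≤ (2τ_int + 1)/c`. -/
theorem imhOp_tauInt_le_of_model_ge {q' : X → ℝ} (hw0 : ∀ t, 0 < w t) (hwm : Measurable w)
    (hwi : Integrable w μ) (hq0 : ∀ t, 0 < q t) (hqm : Measurable q) (hqi : Integrable q μ)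
    (hq1 : ∫ z, q z ∂μ = 1) (hq0' : ∀ t, 0 < q' t) (hqm' : Measurable q') (hqi' : Integrable q' μ)
    (hq1' : ∫ z, q' z ∂μ = 1) {c : ℝ} (hc : 0 < c) (hqq : ∀ t, c * q t ≤ q' t) {g : X → ℝ}
    (hgm : Measurable g) {B : ℝ} (hgb : ∀ t, |g t| ≤ B)
    (hs : Summable fun k => ∫ t, g t * ((imhOp μ w q)^[k + 1] g) t * w t ∂μ)
    (hA : 0 < ∫ t, g t ^ 2 * w t ∂μ) :
    tauInt (fun k => (∫ t, g t * ((imhOp μ w q')^[k] g) t * w t ∂μ) / ∫ t, g t ^ 2 * w t ∂μ) + 1 / 2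
      ≤ (tauInt (fun k => (∫ t, g t * ((imhOp μ w q)^[k] g) t * w t ∂μ) / ∫ t, g t ^ 2 * w t ∂μ)
          + 1 / 2) / c := by
  obtain ⟨-, hle⟩ := greenKubo_le_of_model_ge hw0 hwm hwi hq0 hqm hqi hq1 hq0' hqm' hqi' hq1' hc hqq
    hgm hgb hs
  set A : ℝ := ∫ t, g t ^ 2 * w t ∂μ with hAdef
  set T : ℝ := ∑' k, ∫ t, g t * ((imhOp μ w q)^[k + 1] g) t * w t ∂μ with hTdef
  set T' : ℝ := ∑' k, ∫ t, g t * ((imhOp μ w q')^[k + 1] g) t * w t ∂μ with hT'def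
  simp only [tauInt]
  rw [tsum_div_const, tsum_div_const]
  change 1 / 2 + T' / A + 1 / 2 ≤ (1 / 2 + T / A + 1 / 2) / c
  have hAne := hA.ne'
  have hcne := hc.ne'
  have e1 : 1 / 2 + T' / A + 1 / 2 = (A + T') / A := by
    field_simp
    ring
  have e2 : (1 / 2 + T / A + 1 / 2) / c = ((A + T) / c) / A := by
    field_simp
    ring
  rw [e1, e2]
  exact div_le_div_of_nonneg_right hle hA.le

/-! ## §2 The log-parity sandwich -/

omit [MeasurableSpace X] [SFinite μ] in
/-- A uniform log-parity `|log q' − log q| ≤ δ` between positive densities gives the two pointwise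
dominations `e^{−δ} q ≤ q'` and `e^{−δ} q' ≤ q`. -/
theorem model_ge_of_logParity {q' : X → ℝ} (hq0 : ∀ t, 0 < q t) (hq0' : ∀ t, 0 < q' t) {δ : ℝ}
    (hδ : ∀ t, |Real.log (q' t) - Real.log (q t)| ≤ δ) (t : X) :
    Real.exp (-δ) * q t ≤ q' t ∧ Real.exp (-δ) * q' t ≤ q t := by
  have h := abs_le.1 (hδ t)
  constructor
  · have h1 : Real.exp (-δ) ≤ Real.exp (Real.log (q' t) - Real.log (q t)) :=
      Real.exp_le_exp.2 (by linarith [h.1])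
    rw [Real.exp_sub, Real.exp_log (hq0' t), Real.exp_log (hq0 t), le_div_iff₀ (hq0 t)] at h1
    exact h1
  · have h1 : Real.exp (-δ) ≤ Real.exp (Real.log (q t) - Real.log (q' t)) :=
      Real.exp_le_exp.2 (by linarith [h.2])
    rw [Real.exp_sub, Real.exp_log (hq0' t), Real.exp_log (hq0 t), le_div_iff₀ (hq0' t)] at h1
    exact h1

/-- **THE LOG-PARITY SANDWICH FOR `τ_int`.**  `w > 0` measurable integrable (one target); two
models `q, q' > 0` measurable with `∫ q = ∫ q' = 1` and `|log q' − log q| ≤ δ` pointwise; `g`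
bounded measurable with `∫ g² w > 0` and summable autocovariances under `K = imhOp μ w q`.  Then
the autocovariances under `K' = imhOp μ w q'` are summable too and, on `Scoring.tauInt`,
`e^{−δ} (2τ_int + 1) ≤ 2τ'_int + 1 ≤ e^{δ} (2τ_int + 1)`. -/
theorem imhOp_tauInt_logParity_sandwich {q' : X → ℝ} (hw0 : ∀ t, 0 < w t) (hwm : Measurable w)
    (hwi : Integrable w μ) (hq0 : ∀ t, 0 < q t) (hqm : Measurable q) (hqi : Integrable q μ)
    (hq1 : ∫ z, q z ∂μ = 1) (hq0' : ∀ t, 0 < q' t) (hqm' : Measurable q') (hqi' : Integrable q' μ)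
    (hq1' : ∫ z, q' z ∂μ = 1) {δ : ℝ} (hδ : ∀ t, |Real.log (q' t) - Real.log (q t)| ≤ δ)
    {g : X → ℝ} (hgm : Measurable g) {B : ℝ} (hgb : ∀ t, |g t| ≤ B)
    (hs : Summable fun k => ∫ t, g t * ((imhOp μ w q)^[k + 1] g) t * w t ∂μ)
    (hA : 0 < ∫ t, g t ^ 2 * w t ∂μ) :
    Summable (fun k => ∫ t, g t * ((imhOp μ w q')^[k + 1] g) t * w t ∂μ)
    ∧ Real.exp (-δ) * (2 * tauInt (fun k => (∫ t, g t * ((imhOp μ w q)^[k] g) t * w t ∂μ)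
          / ∫ t, g t ^ 2 * w t ∂μ) + 1)
      ≤ 2 * tauInt (fun k => (∫ t, g t * ((imhOp μ w q')^[k] g) t * w t ∂μ)
          / ∫ t, g t ^ 2 * w t ∂μ) + 1
    ∧ 2 * tauInt (fun k => (∫ t, g t * ((imhOp μ w q')^[k] g) t * w t ∂μ) / ∫ t, g t ^ 2 * w t ∂μ) + 1
      ≤ Real.exp δ * (2 * tauInt (fun k => (∫ t, g t * ((imhOp μ w q)^[k] g) t * w t ∂μ)
          / ∫ t, g t ^ 2 * w t ∂μ) + 1) := by
  have hc : 0 < Real.exp (-δ) := Real.exp_pos _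
  have hqq : ∀ t, Real.exp (-δ) * q t ≤ q' t := fun t => (model_ge_of_logParity hq0 hq0' hδ t).1
  have hqq' : ∀ t, Real.exp (-δ) * q' t ≤ q t := fun t => (model_ge_of_logParity hq0 hq0' hδ t).2
  obtain ⟨hs', -⟩ := greenKubo_le_of_model_ge hw0 hwm hwi hq0 hqm hqi hq1 hq0' hqm' hqi' hq1' hc
    hqq hgm hgb hs
  have h1 := imhOp_tauInt_le_of_model_ge hw0 hwm hwi hq0 hqm hqi hq1 hq0' hqm' hqi' hq1' hc hqq
    hgm hgb hs hA
  have h2 := imhOp_tauInt_le_of_model_ge hw0 hwm hwi hq0' hqm' hqi' hq1' hq0 hqm hqi hq1 hc hqq'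
    hgm hgb hs' hA
  set τ : ℝ := tauInt (fun k => (∫ t, g t * ((imhOp μ w q)^[k] g) t * w t ∂μ) / ∫ t, g t ^ 2 * w t ∂μ)
  set τ' : ℝ := tauInt (fun k => (∫ t, g t * ((imhOp μ w q')^[k] g) t * w t ∂μ) / ∫ t, g t ^ 2 * w t ∂μ)
  refine ⟨hs', ?_, ?_⟩
  · -- from `h2 : τ + ½ ≤ (τ' + ½)/e^{−δ}`
    rw [le_div_iff₀ hc] at h2
    linarith
  · -- from `h1 : τ' + ½ ≤ (τ + ½)/e^{−δ} = e^{δ}(τ + ½)`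
    have e : (τ + 1 / 2) / Real.exp (-δ) = Real.exp δ * (τ + 1 / 2) := by
      rw [Real.exp_neg, div_inv_eq_mul, mul_comm]
    rw [e] at h1
    linarith

/-- **Additive form of the sandwich**: under the hypotheses of `imhOp_tauInt_logParity_sandwich`,
`τ'_int − τ_int ≤ (e^{δ} − 1)(τ_int + ½)` and `τ_int − τ'_int ≤ (e^{δ} − 1)(τ'_int + ½)` — the
systematic offset two `δ`-close models can produce in `τ_int` of any bounded observable. -/
theorem imhOp_tauInt_sub_le_of_logParity {q' : X → ℝ} (hw0 : ∀ t, 0 < w t) (hwm : Measurable w)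
    (hwi : Integrable w μ) (hq0 : ∀ t, 0 < q t) (hqm : Measurable q) (hqi : Integrable q μ)
    (hq1 : ∫ z, q z ∂μ = 1) (hq0' : ∀ t, 0 < q' t) (hqm' : Measurable q') (hqi' : Integrable q' μ)
    (hq1' : ∫ z, q' z ∂μ = 1) {δ : ℝ} (hδ : ∀ t, |Real.log (q' t) - Real.log (q t)| ≤ δ)
    {g : X → ℝ} (hgm : Measurable g) {B : ℝ} (hgb : ∀ t, |g t| ≤ B)
    (hs : Summable fun k => ∫ t, g t * ((imhOp μ w q)^[k + 1] g) t * w t ∂μ)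
    (hA : 0 < ∫ t, g t ^ 2 * w t ∂μ) :
    tauInt (fun k => (∫ t, g t * ((imhOp μ w q')^[k] g) t * w t ∂μ) / ∫ t, g t ^ 2 * w t ∂μ)
        - tauInt (fun k => (∫ t, g t * ((imhOp μ w q)^[k] g) t * w t ∂μ) / ∫ t, g t ^ 2 * w t ∂μ)
      ≤ (Real.exp δ - 1)
        * (tauInt (fun k => (∫ t, g t * ((imhOp μ w q)^[k] g) t * w t ∂μ) / ∫ t, g t ^ 2 * w t ∂μ)
          + 1 / 2)
    ∧ tauInt (fun k => (∫ t, g t * ((imhOp μ w q)^[k] g) t * w t ∂μ) / ∫ t, g t ^ 2 * w t ∂μ)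
        - tauInt (fun k => (∫ t, g t * ((imhOp μ w q')^[k] g) t * w t ∂μ) / ∫ t, g t ^ 2 * w t ∂μ)
      ≤ (Real.exp δ - 1)
        * (tauInt (fun k => (∫ t, g t * ((imhOp μ w q')^[k] g) t * w t ∂μ) / ∫ t, g t ^ 2 * w t ∂μ)
          + 1 / 2) := by
  obtain ⟨-, h1, h2⟩ := imhOp_tauInt_logParity_sandwich hw0 hwm hwi hq0 hqm hqi hq1 hq0' hqm' hqi'
    hq1' hδ hgm hgb hs hA
  -- the reverse sandwich (roles of `q`, `q'` exchanged) gives the second one-sided bound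
  have hδ' : ∀ t, |Real.log (q t) - Real.log (q' t)| ≤ δ := fun t => by
    rw [abs_sub_comm]; exact hδ t
  obtain ⟨hs', -⟩ := greenKubo_le_of_model_ge hw0 hwm hwi hq0 hqm hqi hq1 hq0' hqm' hqi' hq1'
    (Real.exp_pos (-δ)) (fun t => (model_ge_of_logParity hq0 hq0' hδ t).1) hgm hgb hs
  obtain ⟨-, -, h3⟩ := imhOp_tauInt_logParity_sandwich hw0 hwm hwi hq0' hqm' hqi' hq1' hq0 hqm hqi
    hq1 hδ' hgm hgb hs' hA
  constructor
  · linarith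
  · linarith

/-- **The sandwich under the i.i.d.-side hypothesis.**  As `imhOp_tauInt_logParity_sandwich`, with
the chain-side summability replaced by the weight moment `∫ (w/q) w < ∞` of ONE of the two models
and `∫ g w = 0` (then the autocovariance series under `K` is summable by
`tsum_autocov_le_acceptanceCeiling`): `e^{−δ}(2τ_int + 1) ≤ 2τ'_int + 1 ≤ e^{δ}(2τ_int + 1)`. -/
theorem imhOp_tauInt_logParity_sandwich_of_weightMoment {q' : X → ℝ} (hw0 : ∀ t, 0 < w t)
    (hwm : Measurable w) (hwi : Integrable w μ) (hq0 : ∀ t, 0 < q t) (hqm : Measurable q)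
    (hqi : Integrable q μ) (hq1 : ∫ z, q z ∂μ = 1) (hq0' : ∀ t, 0 < q' t) (hqm' : Measurable q')
    (hqi' : Integrable q' μ) (hq1' : ∫ z, q' z ∂μ = 1) {δ : ℝ}
    (hδ : ∀ t, |Real.log (q' t) - Real.log (q t)| ≤ δ)
    (hW₂ : Integrable (fun x => w x / q x * w x) μ) {g : X → ℝ} (hgm : Measurable g) {B : ℝ}
    (hgb : ∀ t, |g t| ≤ B) (hg0 : ∫ x, g x * w x ∂μ = 0) (hA : 0 < ∫ t, g t ^ 2 * w t ∂μ) :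
    Real.exp (-δ) * (2 * tauInt (fun k => (∫ t, g t * ((imhOp μ w q)^[k] g) t * w t ∂μ)
          / ∫ t, g t ^ 2 * w t ∂μ) + 1)
      ≤ 2 * tauInt (fun k => (∫ t, g t * ((imhOp μ w q')^[k] g) t * w t ∂μ)
          / ∫ t, g t ^ 2 * w t ∂μ) + 1
    ∧ 2 * tauInt (fun k => (∫ t, g t * ((imhOp μ w q')^[k] g) t * w t ∂μ) / ∫ t, g t ^ 2 * w t ∂μ) + 1
      ≤ Real.exp δ * (2 * tauInt (fun k => (∫ t, g t * ((imhOp μ w q)^[k] g) t * w t ∂μ)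
          / ∫ t, g t ^ 2 * w t ∂μ) + 1) := by
  have hs := (tsum_autocov_le_acceptanceCeiling hw0 hwm hwi hq0 hqm hqi hq1 hW₂ hgm hgb hg0).1
  exact (imhOp_tauInt_logParity_sandwich hw0 hwm hwi hq0 hqm hqi hq1 hq0' hqm' hqi' hq1' hδ hgm hgb
    hs hA).2

end Summit.Ventures.LatticeQCDFlow.Exactness
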